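import Summits.BirchSwinnertonDyer.BirchSwinnertonDyer.Theses.PlecticLegs
import Literature.Barriers.BirchSwinnertonDyer.RankNotSumOfLocalInvariantsDescentK41
import Literature.Barriers.BirchSwinnertonDyer.RankNotSumOfLocalInvariantsCNRanksA
import Literature.NumberTheory.EllipticCurves.AnalyticRankOverNumberFieldProofs
import Literature.NumberTheory.EllipticCurves.CongruentNumberCurveRootNumberEven
import Literature.NumberTheory.EllipticCurves.CongruentNumberCurveLSeriesProofs
import Literature.NumberTheory.EllipticCurves.LFunctionSmulProofs
import Literature.NumberTheory.EllipticCurves.BSDInvariantsProofs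
import Literature.NumberTheory.EllipticCurves.BSDAnalyticRankProofs
import Literature.NumberTheory.EllipticCurves.MordellWeilTheoremProofs
import Literature.NumberTheory.QuadraticFields.FundamentalDiscriminant
import HarnessLib

/-!
# Negative lemmas for crux `PlecticLegs.PlecticPointsLB` (stmt-BirchSwinnertonDyer-17518):
# the analytic hypothesis `V.analyticRank = [F:ℚ]` is load-bearing, and so is its EXACTNESS

Refuter / crux-disprover file (Negative lane, `--supports stmt-BirchSwinnertonDyer-17518`; it does
NOT refute the crux). `PlecticPointsLB` reads
`∀ F [NumberField F] [IsTotallyReal F] (V : WeierstrassCurve F) [V.IsElliptic],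
2 ≤ [F:ℚ] → V.analyticRank = [F:ℚ] → [F:ℚ] ≤ rank_ℤ V(F)`.
Two sorry-free facts (the only declarations of this file), both over honest totally real quadratic fields and with every input proved
in the tree (axioms `propext`, `Classical.choice`, `Quot.sound` only):

* `plecticPointsLB_false_without_analyticRank` — with the hypothesis `V.analyticRank = [F:ℚ]`
  DROPPED the statement is false: `F = ℚ(√41)`, `V = 480a1`, `rank_ℤ V(F) ≤ 1 < 2` by the tree's
  complete `2`-descent over `ℚ(√41)`
  (`DokchitserDokchitser2011.mordellWeilRank_480a1_K41_le_one`).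
* `plecticPointsLB_false_without_exactOrder` — with `V.analyticRank = [F:ℚ]` WEAKENED to
  `V.analyticRank ≠ 0` ("`L(V/F, 1) = 0`, order unspecified") the statement is false:
  `F = ℚ(√6)`, `V = E₁ : y² = x³ − x` over `F`. Analytic side: `r_an(V/F) = r_an(E₁) + r_an(E₆)`
  (Artin formalism for a quadratic base change, `analyticRankOver_eq_add_of_finrank_eq_two`, with
  `d_F = 24 = 6·2²` and `E₁^{(24)} ≅ E₆`; `F` is the quadratic field of discriminant `24` supplied by
  `Quadratic.exists_numberField_discr_eq`), and `r_an(E₆) ≠ 0` because `L(E₆, 1) = 0` (root number `−1`,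
  `entireLFunction_congruentNumberCurve_one_eq_zero_of_mod_eight`, Hecke continuation
  `hasEntireLFunction_congruentNumberCurve_holds`). Arithmetic side:
  `rank V(F) = rank E₁(ℚ) + rank E₆(ℚ) = 0 + 1 = 1 < 2` (Mordell–Weil `module_finite_point_holds`,
  `mordellWeilRank_baseChange_of_finrank_eq_two_of_finite`, and the complete `2`-descents
  `CongruentDescent.E1/E6.mordellWeilRank_eq`). In truth `r_an(V/F) = 1`: one plectic direction
  short of the regime.

Consequences for provers (see the crux work-file `Cruxes/PlecticPointsLB/Disproof.lean`): the lower
bound is not a property of totally real fields, of the degree, or of mere central vanishing — any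
proof must consume the EXACT order `[F:ℚ]` (equivalently, given `L(V/F,1) = 0`, the information
`ord ≥ [F:ℚ]`), exactly the input a plectic Gross–Zagier formula for the `[F:ℚ]`-th derivative would
supply. The other two hypotheses (`IsTotallyReal F`, `2 ≤ [F:ℚ]`) are NOT load-bearing for truth
(dropping them leaves consequences of BSD over number fields resp. of Gross–Zagier–Kolyvagin), so
no `_false_without_` theorem exists for them. [folklore]
-/

set_option linter.dupNamespace false -- `Summit.BirchSwinnertonDyer.BirchSwinnertonDyer.…`: single-conjunct summit, Sub = Summit (D-0017)

noncomputable section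

open scoped Classical

namespace Summit.BirchSwinnertonDyer.BirchSwinnertonDyer.Theorems

open Literature.NumberTheory.EllipticCurves WeierstrassCurve
open Literature.NumberTheory.QuadraticFields
open NumberField NumberField.InfinitePlace

/-! ## Dropping the analytic-rank hypothesis -/

/-- **`PlecticPointsLB` without `V.analyticRank = [F:ℚ]` is false**: witness `F = ℚ(√41)`
(totally real, degree `2`), `V = 480a1`, `rank_ℤ V(F) ≤ 1` (complete `2`-descent over `ℚ(√41)`,
Dokchitser–Dokchitser 2011, proof of Thm. 2, certified in tree).
[cite: DokchitserDokchitser2011RankModN, proof of Thm. 2] -/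
theorem PlecticPointsLBNegative.plecticPointsLB_false_without_analyticRank :
    ¬ (∀ (F : Type) [Field F] [NumberField F] [NumberField.IsTotallyReal F]
        (V : WeierstrassCurve F) [V.IsElliptic],
        2 ≤ Module.finrank ℚ F → Module.finrank ℚ F ≤ V.mordellWeilRank) := by
  intro h
  haveI : NumberField.IsTotallyReal Sqrt41.K := nrComplexPlaces_eq_zero_iff.mp Sqrt41.places.2
  haveI := Literature.Barriers.BirchSwinnertonDyer.curve480a1.isElliptic_baseChange Sqrt41.K
  have h1 := h Sqrt41.K (Literature.Barriers.BirchSwinnertonDyer.curve480a1.baseChange Sqrt41.K)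
    (by rw [Sqrt41.finrank_eq_two])
  have h2 :=
    Literature.Barriers.BirchSwinnertonDyer.DokchitserDokchitser2011.mordellWeilRank_480a1_K41_le_one
  rw [Sqrt41.finrank_eq_two] at h1
  omega

/-! ## Weakening `r_an(V/F) = [F:ℚ]` to `r_an(V/F) ≠ 0` -/

/-- **Central vanishing alone does not give `[F:ℚ]` points: `PlecticPointsLB` with
`V.analyticRank = [F:ℚ]` weakened to `V.analyticRank ≠ 0` is false.** Witness `F = ℚ(√6)`,
`V = E₁/F` (`E₁ : y² = x³ - x`): `L(V/F, s) = L(E₁, s) L(E₆, s)` vanishes at `s = 1` since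
`L(E₆, 1) = 0` (Koblitz, Ch. II §5: root number `-1` for `n ≡ 6 (mod 8)`), while
`rank V(F) = rank E₁(ℚ) + rank E₆(ℚ) = 0 + 1 = 1 < 2` (Silverman AEC Exercise 10.16 and the
complete `2`-descents Prop. X.1.4). [cite: SilvermanAEC2009, Exercise 10.16 and Prop. X.1.4] -/
theorem PlecticPointsLBNegative.plecticPointsLB_false_without_exactOrder :
    ¬ (∀ (F : Type) [Field F] [NumberField F] [NumberField.IsTotallyReal F]
        (V : WeierstrassCurve F) [V.IsElliptic],
        2 ≤ Module.finrank ℚ F → V.analyticRank ≠ 0 → Module.finrank ℚ F ≤ V.mordellWeilRank) := by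
  intro h
  -- the real quadratic field of discriminant `24 = 4·6`, i.e. `ℚ(√6)`
  obtain ⟨K, _, _, h2, hdK⟩ :=
    Literature.NumberTheory.QuadraticFields.Quadratic.exists_numberField_discr_eq (D := 24)
      (Or.inr ⟨by norm_num, Or.inl (by norm_num), by
        rw [← Int.squarefree_natAbs, show ((24 : ℤ) / 4).natAbs = 2 * 3 by norm_num,
          Nat.squarefree_mul (by norm_num)]
        exact ⟨Nat.prime_two.prime.squarefree, Nat.prime_three.prime.squarefree⟩⟩)
  haveI : NumberField.IsTotallyReal K := by
    rw [← NumberField.nrComplexPlaces_eq_zero_iff]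
    have hsign := NumberField.sign_discr K
    rw [hdK] at hsign
    have heven : Even (NumberField.InfinitePlace.nrComplexPlaces K) := by
      by_contra hodd
      rw [Nat.not_even_iff_odd] at hodd
      rw [hodd.neg_one_pow] at hsign
      norm_num at hsign
    have hrk := NumberField.InfinitePlace.card_add_two_mul_card_eq_rank K
    rw [h2] at hrk
    obtain ⟨m, hm⟩ := heven
    omega
  haveI hE1 : (congruentNumberCurve 1).IsElliptic := isElliptic_congruentNumberCurve one_ne_zero
  haveI hE6 : (congruentNumberCurve 6).IsElliptic := isElliptic_congruentNumberCurve (by norm_num)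
  haveI : ((congruentNumberCurve 1).baseChange K).IsElliptic :=
    inferInstanceAs ((congruentNumberCurve 1).map (algebraMap ℚ K)).IsElliptic
  -- `E₁^{(d_K)} = E₁^{(6·2²)} ≅ E₁^{(6)} = E₆`
  have htw : (congruentNumberCurve 1).quadraticTwist 6 = congruentNumberCurve 6 := by
    ext <;> norm_num [quadraticTwist, congruentNumberCurve, b₂, b₄, b₆]
  obtain ⟨C, hC⟩ :=
    (congruentNumberCurve 1).exists_variableChange_quadraticTwist_mul_sq (6 : ℚ) 2 two_ne_zero
  have hdisc : (congruentNumberCurve 1).quadraticTwist (NumberField.discr K : ℚ) =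
      C • congruentNumberCurve 6 := by
    rw [hdK, ← htw, hC]
    push_cast
    norm_num
  have hsq6 : Squarefree 6 := by
    rw [show (6 : ℕ) = 2 * 3 from rfl, Nat.squarefree_mul (by norm_num)]
    exact ⟨Nat.prime_two.prime.squarefree, Nat.prime_three.prime.squarefree⟩
  have hE6ent : (congruentNumberCurve 6).HasEntireLFunction :=
    hasEntireLFunction_congruentNumberCurve_holds hsq6
  have hW : (congruentNumberCurve 1).HasEntireLFunction :=
    hasEntireLFunction_congruentNumberCurve_holds squarefree_one
  have hWd : ((congruentNumberCurve 1).quadraticTwist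
      (NumberField.discr K : ℚ)).HasEntireLFunction := by
    rw [hdisc]; exact (hasEntireLFunction_smul_iff _ C).mpr hE6ent
  -- analytic side: `r_an(V/F) = r_an(E₁) + r_an(E₆) ≠ 0`
  have hran := (congruentNumberCurve 1).analyticRankOver_eq_add_of_finrank_eq_two K h2 hW hWd
  have h6 : (congruentNumberCurve 6).analyticRank ≠ 0 :=
    analyticRank_ne_zero_of_entireLFunction_one_eq_zero _ hE6ent
      (entireLFunction_congruentNumberCurve_one_eq_zero_of_mod_eight hsq6 (by norm_num))
  have hne : ((congruentNumberCurve 1).baseChange K).analyticRank ≠ 0 := by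
    change (congruentNumberCurve 1).analyticRankOver K ≠ 0
    rw [hran, hdisc, analyticRank_smul]
    omega
  -- arithmetic side: `rank V(F) = rank E₁(ℚ) + rank E₆(ℚ) = 0 + 1`
  haveI : Module.Finite ℤ ((congruentNumberCurve 1).baseChange K).toAffine.Point :=
    module_finite_point_holds _
  have hrk := (congruentNumberCurve 1).mordellWeilRank_baseChange_of_finrank_eq_two_of_finite K h2
  have hr6 : ((congruentNumberCurve 1).quadraticTwist
      (NumberField.discr K : ℚ)).mordellWeilRank = 1 := by
    rw [hdisc]
    exact (mordellWeilRank_variableChange_holds _ C).trans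
      Literature.Barriers.BirchSwinnertonDyer.CongruentDescent.E6.mordellWeilRank_eq
  have hr1 : (congruentNumberCurve 1).mordellWeilRank = 0 :=
    Literature.Barriers.BirchSwinnertonDyer.CongruentDescent.E1.mordellWeilRank_eq
  have h1 := h K ((congruentNumberCurve 1).baseChange K) (by omega) hne
  rw [h2, hrk, hr1, hr6] at h1
  omega

end Summit.BirchSwinnertonDyer.BirchSwinnertonDyer.Theorems

end
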